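import Summits.KontsevichZagierPeriods.KontsevichZagierPeriods.Theses.SymplecticScissors
import Summits.KontsevichZagierPeriods.KontsevichZagierPeriods.Theorems.PlanarK0Injective.Negative.Kit
import Summits.KontsevichZagierPeriods.KontsevichZagierPeriods.Theorems.SymplecticScissorsFiniteMapShear
import Literature.NumberTheory.Transcendental.KZSemialgebraicComplex
import Literature.NumberTheory.Transcendental.KZSemiCanonicalReductionProofs
import Literature.NumberTheory.Transcendental.SemialgebraicLineDeriv
import Literature.NumberTheory.Transcendental.KZGroundingRelations

/-!
# `PlanarK0Injective` (stmt-KontsevichZagierPeriods-9847) — line `kernel-subgroup-homotopy`,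
stub `stub_torsionCalibration` (genus-1 calibration: the 3-torsion translation on `y² = x³ + 1`)

On the elliptic curve `E : y² = x³ + 1` (`E(ℚ)_tors = ℤ/6`: `(2, ±3)` of order 6, `(0, ±1)` of order 3,
`(−1, 0)` of order 2) translation by the 3-torsion point `(0, 1)` carries the real arc over
`x ∈ (−1, 0)` (from `(−1,0)` to `(0,1)`) onto the arc over `x ∈ (0, 2)` (from `(2,−3)` to `(0,−1)`)
and preserves `ω = dx/y`, so `∫₋₁⁰ dx/√(x³+1) = ∫₀² dx/√(x³+1)` (`= Ω/6`, numerically `1.4021821053`).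
As PLANAR MOVES: reflect the cell `{−1 < x < 0, 0 < y, y²(x³+1) < 1}` by `(x, y) ↦ (−x, y)`
(rule 2, `|det| = 1`) onto `{0 < u < 1, 0 < y, y²(1 − u³) < 1}` = subgraph of `1/√(1−u³)` over `(0,1)`,
then ONE `FiniteMapShear` with `φ(u) = 2u/(1 + √(1 − u³))` (`= 2(1 − s)/u²`, `s = √(1 − u³)`;
`φ′ = (3 − s)/(s(1 + s)) > 0`, `√(φ³ + 1) = (3 − s)/(1 + s)`, hence `φ′/√(φ³+1) = 1/s`; `φ(0⁺) = 0`,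
`φ(1⁻) = 2`) and `w(X) = 1/√(X³ + 1)` carries it onto `{0 < X < 2, 0 < y, y²(X³+1) < 1}`.
[Kontsevich–Zagier 2001, §1.2 rules (1a), (2); folklore (torsion translations preserve the invariant differential)]
-/

noncomputable section

open MeasureTheory Set MvPolynomial
open Literature.NumberTheory.Transcendental Literature.ModelTheory.ExponentialFields
open Summit.KontsevichZagierPeriods.SymplecticScissors.PlanarK0InjectiveNegative (planarGroup
  planarGens of_mem_planarGroup_of_volume_eq_zero of_sub_of_mem_planarGroup_of_domain_eq)
open Summit.KontsevichZagierPeriods.SymplecticScissors.FiniteMapShear (finiteMapShear_proof)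

namespace Summit.KontsevichZagierPeriods.SymplecticScissors.KernelSubgroupHomotopy

/-! ## Elementary algebra around `s = √(1 − u³)` -/

/-- `0 < 1 − u³` for `0 < u < 1`. [folklore] -/
private theorem tc_one_sub_cube_pos {u : ℝ} (h0 : 0 < u) (h1 : u < 1) : 0 < 1 - u ^ 3 :=
  sub_pos.2 (pow_lt_one₀ h0.le h1 three_ne_zero)

/-- For `y, a > 0`: `y < 1/√a ↔ y² a < 1`. [folklore] -/
private theorem tc_lt_inv_sqrt_iff {y a : ℝ} (hy : 0 < y) (ha : 0 < a) :
    y < (√a)⁻¹ ↔ y ^ 2 * a < 1 := by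
  have hs : 0 < √a := Real.sqrt_pos.2 ha
  have hs2 : (√a) ^ 2 = a := Real.sq_sqrt ha.le
  rw [← one_div, lt_div_iff₀ hs, show y ^ 2 * a = (y * √a) ^ 2 by rw [mul_pow, hs2]]
  exact (pow_lt_one_iff_of_nonneg (mul_pos hy hs).le two_ne_zero).symm

/-- The derivative identity `(2(1+s) + 3u³/s)/(1+s)² = (3 − s)/(s(1+s))` for `s² = 1 − u³`, `s > 0`.
[folklore] -/
private theorem tc_alg_deriv {u s : ℝ} (hs : 0 < s) (hs2 : s ^ 2 = 1 - u ^ 3) :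
    (2 * (1 + s) - 2 * u * (-(3 * u ^ 2) / (2 * s))) / (1 + s) ^ 2 = (3 - s) / (s * (1 + s)) := by
  have h1 : (1 + s) ≠ 0 := by positivity
  have h2 : s ≠ 0 := hs.ne'
  rw [div_eq_div_iff (by positivity) (by positivity)]
  field_simp
  linear_combination 3 * hs2

/-- The torsion identity `φ³ + 1 = ((3 − s)/(1 + s))²` for `φ = 2u/(1+s)`, `s² = 1 − u³`, `s ≥ 0`
(because `(1 − s)(1 + s) = u³`). [folklore] -/
private theorem tc_alg_cube {u s : ℝ} (hs : 0 ≤ s) (hs2 : s ^ 2 = 1 - u ^ 3) :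
    (2 * u / (1 + s)) ^ 3 + 1 = ((3 - s) / (1 + s)) ^ 2 := by
  have h1 : (1 + s) ≠ 0 := by positivity
  rw [div_pow, div_pow, div_add_one (pow_ne_zero 3 h1),
    div_eq_div_iff (pow_ne_zero 3 h1) (pow_ne_zero 2 h1)]
  linear_combination (8 * (1 + s) ^ 2) * hs2

/-! ## The torsion shear `φ(u) = 2u/(1 + √(1 − u³))`

Throughout, `φ` is written out as the lambda `fun u : ℝ => 2 * u / (1 + √(1 - u ^ 3))` (no
definition and no notation is introduced). -/

/-- The derivative of `φ` on `(0, 1)`: `φ′ u = (3 − s)/(s(1 + s))`, `s = √(1 − u³)`. [folklore] -/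
private theorem tc_hasDerivAt_phi {u : ℝ} (hu : u ∈ Ioo (0:ℝ) 1) :
    HasDerivAt (fun u : ℝ => 2 * u / (1 + √(1 - u ^ 3)))
      ((3 - √(1 - u ^ 3)) / (√(1 - u ^ 3) * (1 + √(1 - u ^ 3)))) u := by
  have hpos : 0 < 1 - u ^ 3 := tc_one_sub_cube_pos hu.1 hu.2
  have hs : 0 < √(1 - u ^ 3) := Real.sqrt_pos.2 hpos
  have hs2 : √(1 - u ^ 3) ^ 2 = 1 - u ^ 3 := Real.sq_sqrt hpos.le
  have h1 : HasDerivAt (fun u : ℝ => 1 - u ^ 3) (-(3 * u ^ 2)) u := by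
    simpa using (hasDerivAt_pow 3 u).const_sub 1
  have h2 : HasDerivAt (fun u : ℝ => √(1 - u ^ 3)) (-(3 * u ^ 2) / (2 * √(1 - u ^ 3))) u :=
    h1.sqrt hpos.ne'
  have h3 : HasDerivAt (fun u : ℝ => 1 + √(1 - u ^ 3)) (-(3 * u ^ 2) / (2 * √(1 - u ^ 3))) u := by
    simpa using h2.const_add 1
  have h4 : HasDerivAt (fun u : ℝ => 2 * u) 2 u := by
    simpa using (hasDerivAt_id u).const_mul (2:ℝ)
  exact (h4.div h3 (by positivity)).congr_deriv (tc_alg_deriv hs hs2)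

/-- `deriv φ` in closed form on `(0, 1)`. [folklore] -/
private theorem tc_deriv_phi {u : ℝ} (hu : u ∈ Ioo (0:ℝ) 1) :
    deriv (fun u : ℝ => 2 * u / (1 + √(1 - u ^ 3))) u =
      (3 - √(1 - u ^ 3)) / (√(1 - u ^ 3) * (1 + √(1 - u ^ 3))) :=
  (tc_hasDerivAt_phi hu).deriv

/-- `φ′ > 0` on `(0, 1)` (`0 < s < 1 < 3`). [folklore] -/
private theorem tc_deriv_phi_pos {u : ℝ} (hu : u ∈ Ioo (0:ℝ) 1) :
    0 < deriv (fun u : ℝ => 2 * u / (1 + √(1 - u ^ 3))) u := by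
  have hpos : 0 < 1 - u ^ 3 := tc_one_sub_cube_pos hu.1 hu.2
  have hs : 0 < √(1 - u ^ 3) := Real.sqrt_pos.2 hpos
  have hs1 : √(1 - u ^ 3) < 1 := by
    rw [Real.sqrt_lt' one_pos, one_pow]
    have : 0 < u ^ 3 := pow_pos hu.1 3
    linarith
  rw [tc_deriv_phi hu]
  exact div_pos (by linarith) (by positivity)

/-- `φ` is smooth on `(0, 1)` (`1 − u³ ≠ 0` there, `1 + √· ≠ 0`). [folklore] -/
private theorem tc_contDiffOn_phi : ContDiffOn ℝ 2 (fun u : ℝ => 2 * u / (1 + √(1 - u ^ 3))) (Ioo (0:ℝ) 1) := by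
  refine ContDiffOn.div (contDiffOn_const.mul contDiffOn_id) (contDiffOn_const.add
    (ContDiffOn.sqrt (contDiffOn_const.sub (contDiffOn_id.pow 3)) fun x hx => ?_)) fun x _ => ?_
  · exact (tc_one_sub_cube_pos hx.1 hx.2).ne'
  · positivity

/-- `φ` is continuous on `ℝ`. [folklore] -/
private theorem tc_continuous_phi : Continuous (fun u : ℝ => 2 * u / (1 + √(1 - u ^ 3))) :=
  (continuous_const.mul continuous_id).div
    (continuous_const.add ((continuous_const.sub (continuous_pow 3)).sqrt)) fun x => by positivity

/-- `φ '' (0, 1) = (0, 2)` (`φ 0 = 0`, `φ 1 = 2`, `0 < φ < 2` inside, intermediate values). [folklore] -/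
private theorem tc_image_phi : (fun u : ℝ => 2 * u / (1 + √(1 - u ^ 3))) '' Ioo (0:ℝ) 1 = Ioo 0 2 := by
  apply Subset.antisymm
  · rintro _ ⟨u, ⟨h0, h1⟩, rfl⟩
    beta_reduce
    have hs : 0 ≤ √(1 - u ^ 3) := Real.sqrt_nonneg _
    have hd : 0 < 1 + √(1 - u ^ 3) := by positivity
    refine ⟨div_pos (by linarith) hd, ?_⟩
    rw [div_lt_iff₀ hd]
    linarith
  · have h := intermediate_value_Ioo (show (0:ℝ) ≤ 1 by norm_num)
      (f := (fun u : ℝ => 2 * u / (1 + √(1 - u ^ 3)))) tc_continuous_phi.continuousOn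
    simpa using h

/-- `√(φ³ + 1) = (3 − s)/(1 + s)` on `(0, 1)`. [folklore] -/
private theorem tc_sqrt_phi_cube {u : ℝ} (hu : u ∈ Ioo (0:ℝ) 1) :
    √((2 * u / (1 + √(1 - u ^ 3))) ^ 3 + 1) = (3 - √(1 - u ^ 3)) / (1 + √(1 - u ^ 3)) := by
  have hpos : 0 < 1 - u ^ 3 := tc_one_sub_cube_pos hu.1 hu.2
  have hs : 0 ≤ √(1 - u ^ 3) := Real.sqrt_nonneg _
  have hs1 : √(1 - u ^ 3) < 1 := by
    rw [Real.sqrt_lt' one_pos, one_pow]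
    have : 0 < u ^ 3 := pow_pos hu.1 3
    linarith
  rw [tc_alg_cube hs (Real.sq_sqrt hpos.le), Real.sqrt_sq]
  exact div_nonneg (by linarith) (by positivity)

/-- The invariance of `dx/y` under the torsion translation: `φ′ u / √(φ u ³ + 1) = 1/√(1 − u³)`.
[folklore] -/
private theorem tc_w_phi_mul_deriv {u : ℝ} (hu : u ∈ Ioo (0:ℝ) 1) :
    (√((2 * u / (1 + √(1 - u ^ 3))) ^ 3 + 1))⁻¹ * deriv (fun u : ℝ => 2 * u / (1 + √(1 - u ^ 3))) u =
      (√(1 - u ^ 3))⁻¹ := by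
  have hpos : 0 < 1 - u ^ 3 := tc_one_sub_cube_pos hu.1 hu.2
  have hs : 0 < √(1 - u ^ 3) := Real.sqrt_pos.2 hpos
  have hs1 : √(1 - u ^ 3) < 1 := by
    rw [Real.sqrt_lt' one_pos, one_pow]
    have : 0 < u ^ 3 := pow_pos hu.1 3
    linarith
  have h3 : (3 - √(1 - u ^ 3)) ≠ 0 := by linarith
  have h1 : (1 + √(1 - u ^ 3)) ≠ 0 := by positivity
  rw [tc_sqrt_phi_cube hu, tc_deriv_phi hu]
  field_simp

/-! ## Semialgebraicity -/

/-- `{z | a < z 0 < b}` is `ℚ`-semialgebraic for rational `a, b`. [folklore] -/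
private theorem tc_isSemialgebraic_strip (a b : ℚ) :
    IsSemialgebraic ℚ {z : Fin 1 → ℝ | z 0 ∈ Ioo (a : ℝ) b} := by
  have h := (isSemialgebraic_setOf_eval_lt (k := ℚ) (R := ℝ) (ι := Fin 1) (C a) (X 0)).inter
    (isSemialgebraic_setOf_eval_lt (k := ℚ) (R := ℝ) (ι := Fin 1) (X 0) (C b))
  have hEq : {z : Fin 1 → ℝ | z 0 ∈ Ioo (a : ℝ) b} =
      {x : Fin 1 → ℝ | aeval x (C a : MvPolynomial (Fin 1) ℚ) < aeval x (X 0 : MvPolynomial (Fin 1) ℚ)} ∩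
      {x : Fin 1 → ℝ | aeval x (X 0 : MvPolynomial (Fin 1) ℚ) <
        aeval x (C b : MvPolynomial (Fin 1) ℚ)} := by
    ext z; simp
  rw [hEq]; exact h

/-- The reflected cell `{0 < u < 1, 0 < y, y²(1 − u³) < 1}` is `ℚ`-semialgebraic. [folklore] -/
private theorem tc_isSemialgebraic_cell :
    IsSemialgebraic ℚ {q : Fin 2 → ℝ | 0 < q 0 ∧ q 0 < 1 ∧ 0 < q 1 ∧ q 1 ^ 2 * (1 - q 0 ^ 3) < 1} := by
  have h := (((isSemialgebraic_setOf_eval_lt (k := ℚ) (R := ℝ) (ι := Fin 2) (C 0) (X 0)).inter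
    (isSemialgebraic_setOf_eval_lt (k := ℚ) (R := ℝ) (ι := Fin 2) (X 0) (C 1))).inter
    (isSemialgebraic_setOf_eval_lt (k := ℚ) (R := ℝ) (ι := Fin 2) (C 0) (X 1))).inter
    (isSemialgebraic_setOf_eval_lt (k := ℚ) (R := ℝ) (ι := Fin 2) (X 1 ^ 2 * (1 - X 0 ^ 3)) (C 1))
  have hEq : {q : Fin 2 → ℝ | 0 < q 0 ∧ q 0 < 1 ∧ 0 < q 1 ∧ q 1 ^ 2 * (1 - q 0 ^ 3) < 1} =
      (({x : Fin 2 → ℝ | aeval x (C 0 : MvPolynomial (Fin 2) ℚ) < aeval x (X 0 : MvPolynomial (Fin 2) ℚ)} ∩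
      {x : Fin 2 → ℝ | aeval x (X 0 : MvPolynomial (Fin 2) ℚ) < aeval x (C 1 : MvPolynomial (Fin 2) ℚ)}) ∩
      {x : Fin 2 → ℝ | aeval x (C 0 : MvPolynomial (Fin 2) ℚ) < aeval x (X 1 : MvPolynomial (Fin 2) ℚ)}) ∩
      {x : Fin 2 → ℝ | aeval x (X 1 ^ 2 * (1 - X 0 ^ 3) : MvPolynomial (Fin 2) ℚ) <
        aeval x (C 1 : MvPolynomial (Fin 2) ℚ)} := by
    ext q
    simp [and_assoc]
  rw [hEq]; exact h

/-- `z ↦ φ (z 0)` is `ℚ`-semialgebraic on every `ℚ`-semialgebraic `S ⊆ ℝ¹`. [folklore] -/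
private theorem tc_sa_phi {S : Set (Fin 1 → ℝ)} (hS : IsSemialgebraic ℚ S) :
    IsSemialgebraicFunOn ℚ S (fun z => 2 * z 0 / (1 + √(1 - z 0 ^ 3))) := by
  have h0 : IsSemialgebraicFunOn ℚ S (fun z => z 0) := by
    simpa using isSemialgebraicFunOn_aeval hS (X 0 : MvPolynomial (Fin 1) ℚ)
  have h1 : IsSemialgebraicFunOn ℚ S (fun _ => (1 : ℝ)) := by
    simpa using isSemialgebraicFunOn_const_natCast hS 1
  have h2 : IsSemialgebraicFunOn ℚ S (fun _ => (2 : ℝ)) := isSemialgebraicFunOn_const_ofNat hS 2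
  have hs : IsSemialgebraicFunOn ℚ S (fun z => √(1 - z 0 ^ 3)) := (h1.fun_sub (h0.fun_pow 3)).fun_sqrt
  exact IsSemialgebraicFunOn.div (h2.fun_mul h0) (h1.fun_add hs) fun z _ => by positivity

/-- `z ↦ (3 − s)/(s(1 + s))`, `s = √(1 − (z 0)³)`, is `ℚ`-semialgebraic on every `ℚ`-semialgebraic
`S ⊆ ℝ¹` (Mathlib's junk inverse included). [folklore] -/
private theorem tc_sa_dphi {S : Set (Fin 1 → ℝ)} (hS : IsSemialgebraic ℚ S) :
    IsSemialgebraicFunOn ℚ S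
      (fun z => (3 - √(1 - z 0 ^ 3)) / (√(1 - z 0 ^ 3) * (1 + √(1 - z 0 ^ 3)))) := by
  have h0 : IsSemialgebraicFunOn ℚ S (fun z => z 0) := by
    simpa using isSemialgebraicFunOn_aeval hS (X 0 : MvPolynomial (Fin 1) ℚ)
  have h1 : IsSemialgebraicFunOn ℚ S (fun _ => (1 : ℝ)) := by
    simpa using isSemialgebraicFunOn_const_natCast hS 1
  have h3 : IsSemialgebraicFunOn ℚ S (fun _ => (3 : ℝ)) := isSemialgebraicFunOn_const_ofNat hS 3
  have hs : IsSemialgebraicFunOn ℚ S (fun z => √(1 - z 0 ^ 3)) := (h1.fun_sub (h0.fun_pow 3)).fun_sqrt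
  exact ((h3.fun_sub hs).fun_mul (hs.fun_mul (h1.fun_add hs)).fun_inv).congr
    fun z _ => (div_eq_mul_inv _ _).symm

/-- `z ↦ 1/√((z 0)³ + 1)` is `ℚ`-semialgebraic on every `ℚ`-semialgebraic `S ⊆ ℝ¹`. [folklore] -/
private theorem tc_sa_w {S : Set (Fin 1 → ℝ)} (hS : IsSemialgebraic ℚ S) :
    IsSemialgebraicFunOn ℚ S (fun z => (√(z 0 ^ 3 + 1))⁻¹) := by
  have h0 : IsSemialgebraicFunOn ℚ S (fun z => z 0) := by
    simpa using isSemialgebraicFunOn_aeval hS (X 0 : MvPolynomial (Fin 1) ℚ)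
  have h1 : IsSemialgebraicFunOn ℚ S (fun _ => (1 : ℝ)) := by
    simpa using isSemialgebraicFunOn_const_natCast hS 1
  exact ((h0.fun_pow 3).fun_add h1).fun_sqrt.fun_inv

/-! ## The reflection `(x, y) ↦ (−x, y)` -/

/-- The reflection `(x, y) ↦ (−x, y)` of the plane is a continuous linear map of determinant `−1`
(no definition is introduced: consumers only use the two displayed properties). [folklore] -/
private theorem tc_exists_refl :
    ∃ L : (Fin 2 → ℝ) →L[ℝ] (Fin 2 → ℝ), (∀ q, L q = ![-q 0, q 1]) ∧ L.det = -1 := by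
  let L : (Fin 2 → ℝ) →L[ℝ] (Fin 2 → ℝ) := ContinuousLinearMap.pi
    ![-(ContinuousLinearMap.proj (R := ℝ) (φ := fun _ : Fin 2 => ℝ) 0),
      ContinuousLinearMap.proj (R := ℝ) (φ := fun _ : Fin 2 => ℝ) 1]
  have hL : ∀ q, L q = ![-q 0, q 1] := fun q => by
    ext i
    fin_cases i <;> simp [L]
  refine ⟨L, hL, ?_⟩
  have h : (L : (Fin 2 → ℝ) →ₗ[ℝ] (Fin 2 → ℝ)) = Matrix.toLin' !![-1, 0; 0, 1] := by
    apply LinearMap.ext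
    intro v
    rw [ContinuousLinearMap.coe_coe, hL, Matrix.toLin'_apply]
    ext i
    fin_cases i <;> simp [Matrix.mulVec, dotProduct, Fin.sum_univ_two]
  rw [ContinuousLinearMap.det, h, LinearMap.det_toLin', Matrix.det_fin_two]
  simp

/-- The reflection is an involution. [folklore] -/
private theorem tc_refl_refl {L : (Fin 2 → ℝ) → (Fin 2 → ℝ)} (hL : ∀ q, L q = ![-q 0, q 1])
    (q : Fin 2 → ℝ) : L (L q) = q := by
  rw [hL, hL]
  ext i
  fin_cases i <;> simp

/-- The reflection is injective. [folklore] -/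
private theorem tc_injective_refl {L : (Fin 2 → ℝ) → (Fin 2 → ℝ)} (hL : ∀ q, L q = ![-q 0, q 1]) :
    Function.Injective L :=
  Function.Involutive.injective (tc_refl_refl hL)

/-- The reflection is a polynomial map with rational coefficients, hence `ℚ`-semialgebraic on every
`ℚ`-semialgebraic set. [folklore] -/
private theorem tc_isSemialgebraicMapOn_refl {L : (Fin 2 → ℝ) → (Fin 2 → ℝ)}
    (hL : ∀ q, L q = ![-q 0, q 1]) {s : Set (Fin 2 → ℝ)} (hs : IsSemialgebraic ℚ s) :
    IsSemialgebraicMapOn ℚ s L := by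
  refine (isSemialgebraicMapOn_aeval hs ![-X 0, X 1]).congr fun p _ => ?_
  rw [hL]
  ext j
  fin_cases j <;> simp

/-- The reflection carries the cell over `(−1, 0)` onto the cell `{0 < u < 1, 0 < y, y²(1 − u³) < 1}`.
[folklore] -/
private theorem tc_image_refl {L : (Fin 2 → ℝ) → (Fin 2 → ℝ)} (hL : ∀ q, L q = ![-q 0, q 1]) :
    L '' {p : Fin 2 → ℝ | -1 < p 0 ∧ p 0 < 0 ∧ 0 < p 1 ∧ p 1 ^ 2 * (p 0 ^ 3 + 1) < 1} =
      {q : Fin 2 → ℝ | 0 < q 0 ∧ q 0 < 1 ∧ 0 < q 1 ∧ q 1 ^ 2 * (1 - q 0 ^ 3) < 1} := by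
  ext q
  constructor
  · rintro ⟨p, ⟨h0, h1, h2, h3⟩, rfl⟩
    rw [hL]
    simp only [mem_setOf_eq, Matrix.cons_val_zero, Matrix.cons_val_one, Matrix.cons_val_fin_one]
    refine ⟨by linarith, by linarith, h2, ?_⟩
    have e : p 1 ^ 2 * (1 - (-p 0) ^ 3) = p 1 ^ 2 * (p 0 ^ 3 + 1) := by ring
    rw [e]
    exact h3
  · rintro ⟨h0, h1, h2, h3⟩
    refine ⟨![-q 0, q 1], ⟨?_, ?_, ?_, ?_⟩, ?_⟩
    · simp only [Matrix.cons_val_zero]; linarith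
    · simp only [Matrix.cons_val_zero]; linarith
    · simpa using h2
    · simp only [Matrix.cons_val_zero, Matrix.cons_val_one, Matrix.cons_val_fin_one]
      have e : q 1 ^ 2 * ((-q 0) ^ 3 + 1) = q 1 ^ 2 * (1 - q 0 ^ 3) := by ring
      rw [e]
      exact h3
    · rw [hL]
      ext i
      fin_cases i <;> simp

/-! ## Membership patterns in the planar group -/

/-- A planar instance of rule (2) lies in the planar group. [folklore] -/
private theorem tc_mem_planarGroup_of_cov {r r' : KZ.IntegralRep 2}
    (hr : ∀ p ∈ r.domain, r.integrand p = 1) (hr' : ∀ p ∈ r'.domain, r'.integrand p = 1)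
    (h : KZ.of r - KZ.of r' ∈ KZ.changeOfVariablesRel) : KZ.of r - KZ.of r' ∈ planarGroup :=
  AddSubgroup.subset_closure ⟨Or.inr h, (AddSubgroup.closure planarGens).sub_mem
    (AddSubgroup.subset_closure ⟨r, hr, rfl⟩) (AddSubgroup.subset_closure ⟨r', hr', rfl⟩)⟩

/-! ## The calibration -/

/-- **Calibration (genus 1, torsion).** On `y² = x³ + 1` the cells over `(−1, 0)` and over `(0, 2)` under
`y = 1/√(x³+1)` are congruent in the planar set-chain group (one reflection and one `FiniteMapShear`,
the 3-torsion translation). [Kontsevich–Zagier 2001, §1.2; folklore] -/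
theorem stub_torsionCalibration :
    ∀ (r₁ r₂ : KZ.IntegralRep 2),
      r₁.domain = {p : Fin 2 → ℝ | -1 < p 0 ∧ p 0 < 0 ∧ 0 < p 1 ∧ p 1 ^ 2 * (p 0 ^ 3 + 1) < 1} →
      r₂.domain = {p : Fin 2 → ℝ | 0 < p 0 ∧ p 0 < 2 ∧ 0 < p 1 ∧ p 1 ^ 2 * (p 0 ^ 3 + 1) < 1} →
      (∀ p ∈ r₁.domain, r₁.integrand p = 1) → (∀ p ∈ r₂.domain, r₂.integrand p = 1) →
      KZ.of r₂ - KZ.of r₁ ∈ planarGroup := by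
  intro r₁ r₂ hr₁ hr₂ hi₁ hi₂
  obtain ⟨L, hL, hLdet⟩ := tc_exists_refl
  -- the reflected cell `C = L '' r₁.domain` has the (finite) area of `r₁.domain`
  have himage : L '' r₁.domain =
      {q : Fin 2 → ℝ | 0 < q 0 ∧ q 0 < 1 ∧ 0 < q 1 ∧ q 1 ^ 2 * (1 - q 0 ^ 3) < 1} := by
    rw [hr₁]
    exact tc_image_refl hL
  have hfin : volume {q : Fin 2 → ℝ | 0 < q 0 ∧ q 0 < 1 ∧ 0 < q 1 ∧ q 1 ^ 2 * (1 - q 0 ^ 3) < 1} ≠ ⊤ := by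
    rw [← himage, Measure.addHaar_image_continuousLinearMap]
    have hdet : |LinearMap.det (L : (Fin 2 → ℝ) →ₗ[ℝ] (Fin 2 → ℝ))| = 1 := by
      have h := hLdet
      rw [ContinuousLinearMap.det] at h
      rw [h]
      norm_num
    rw [hdet, ENNReal.ofReal_one, one_mul]
    exact KZ.volume_ne_top_of_integrand_one r₁ hi₁
  obtain ⟨R, hRd, hRi⟩ := KZ.exists_oneRep tc_isSemialgebraic_cell hfin
  have hRi' : ∀ p ∈ R.domain, R.integrand p = 1 := fun p _ => by rw [hRi]
  -- (1) the reflection is ONE rule-2 move from `r₁` onto `R`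
  have h1 : KZ.of r₁ - KZ.of R ∈ planarGroup := by
    refine tc_mem_planarGroup_of_cov hi₁ hRi' ⟨2, r₁, R, L, fun _ => L,
      tc_isSemialgebraicMapOn_refl hL r₁.isSemialgebraic_domain,
      fun x _ => L.hasFDerivAt.hasFDerivWithinAt, (tc_injective_refl hL).injOn, ?_,
      fun x hx => ?_, rfl⟩
    · rw [hRd, himage]
    · rw [hi₁ x hx, hRi, hLdet]
      simp
  -- (2) the torsion shear is ONE `FiniteMapShear` from `R` onto `r₂`
  have hstrip : IsSemialgebraic ℚ {z : Fin 1 → ℝ | z 0 ∈ Ioo (0:ℝ) 1} := by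
    simpa using tc_isSemialgebraic_strip 0 1
  have hφ : IsSemialgebraicFunOn ℚ {z : Fin 1 → ℝ | z 0 ∈ Ioo (0:ℝ) 1}
      (fun z => 2 * z 0 / (1 + √(1 - z 0 ^ 3))) := tc_sa_phi hstrip
  have hφ' : IsSemialgebraicFunOn ℚ {z : Fin 1 → ℝ | z 0 ∈ Ioo (0:ℝ) 1}
      (fun z => deriv (fun u : ℝ => 2 * u / (1 + √(1 - u ^ 3))) (z 0)) :=
    (tc_sa_dphi hstrip).congr fun z hz => (tc_deriv_phi hz).symm
  have hw : IsSemialgebraicFunOn ℚ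
      {z : Fin 1 → ℝ | z 0 ∈ (fun u : ℝ => 2 * u / (1 + √(1 - u ^ 3))) '' Ioo (0:ℝ) 1}
      (fun z => (√(z 0 ^ 3 + 1))⁻¹) := by
    rw [tc_image_phi]
    exact tc_sa_w (by simpa using tc_isSemialgebraic_strip 0 2)
  have hRdom : R.domain = {p : Fin 2 → ℝ | p 0 ∈ Ioo (0:ℝ) 1 ∧ 0 < p 1 ∧
      p 1 < (√((2 * p 0 / (1 + √(1 - p 0 ^ 3))) ^ 3 + 1))⁻¹ *
        deriv (fun u : ℝ => 2 * u / (1 + √(1 - u ^ 3))) (p 0)} := by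
    rw [hRd]
    ext p
    simp only [mem_setOf_eq, mem_Ioo]
    constructor
    · rintro ⟨h0, h1, h2, h3⟩
      refine ⟨⟨h0, h1⟩, h2, ?_⟩
      rw [tc_w_phi_mul_deriv ⟨h0, h1⟩]
      exact (tc_lt_inv_sqrt_iff h2 (tc_one_sub_cube_pos h0 h1)).2 h3
    · rintro ⟨⟨h0, h1⟩, h2, h3⟩
      refine ⟨h0, h1, h2, ?_⟩
      rw [tc_w_phi_mul_deriv ⟨h0, h1⟩] at h3
      exact (tc_lt_inv_sqrt_iff h2 (tc_one_sub_cube_pos h0 h1)).1 h3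
  have hr₂dom : r₂.domain = {q : Fin 2 → ℝ |
      q 0 ∈ (fun u : ℝ => 2 * u / (1 + √(1 - u ^ 3))) '' Ioo (0:ℝ) 1 ∧ 0 < q 1 ∧
      q 1 < (√(q 0 ^ 3 + 1))⁻¹} := by
    rw [hr₂, tc_image_phi]
    ext q
    simp only [mem_setOf_eq, mem_Ioo]
    constructor
    · rintro ⟨h0, h1, h2, h3⟩
      exact ⟨⟨h0, h1⟩, h2, (tc_lt_inv_sqrt_iff h2 (by positivity)).2 h3⟩
    · rintro ⟨⟨h0, h1⟩, h2, h3⟩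
      exact ⟨h0, h1, h2, (tc_lt_inv_sqrt_iff h2 (by positivity)).1 h3⟩
  have h2 : KZ.of R - KZ.of r₂ ∈ planarGroup :=
    tc_mem_planarGroup_of_cov hRi' hi₂ (finiteMapShear_proof 0 1 (fun u : ℝ => 2 * u / (1 + √(1 - u ^ 3)))
      (fun x => (√(x ^ 3 + 1))⁻¹) one_pos hφ hφ' tc_contDiffOn_phi (fun u hu => tc_deriv_phi_pos hu) hw
      R r₂ hRdom hr₂dom hRi' hi₂)
  -- assemble: [r₂] − [r₁] = −(([r₁] − [R]) + ([R] − [r₂]))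
  have h := planarGroup.neg_mem (planarGroup.add_mem h1 h2)
  convert h using 1
  abel

end Summit.KontsevichZagierPeriods.SymplecticScissors.KernelSubgroupHomotopy

end
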